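/-
Origin: expansion seat `planner-pub-hodgecm-mc-theta-3-g14-0`, handover (K14) 2026-08-20T12:03:47Z md5 a1847a04f4fb5ea35725fb9554261443 (172 l., 8 theorems; NEW additive drop-alone leaf over RUN-50 (K13) + `HypCensus/Side34Omg`; (J-μ)₃₄ hμ₃₄ at the OG pin DISCHARGED: η·χ_T·dIotaAt (swapPin c.D (archOf t)) = (printPlacesW … (pinnedVacs … (−μ♯♯ c 2) (−μ♯♯ c 3)) t)⁻¹, any datum, any hW; torus identity weight (μ♯♯0)(μ♯♯1)(swapPin u) = weight (μ♯♯2)(μ♯♯3) u; sha256 9b51913654f9) (`HOME/mc/pub-hodgecm-mc-theta-3-g14/lean/stage51/HodgeCM/Model/ArchPinWeightDischarge34.lean`, md5 a1847a04f4fb, 172 lines);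
landed by the gen-20 packager (p-g20) in gate run 51 as `HodgeCM/Model/ArchPinWeightDischarge34.lean` (verbatim).
-/
/-
Origin: speedrun cell pub-hodgecm, MODEL-CONSTRUCTION sub-cell, lineage mc-theta-3 (theta supply / second-lift lane, BINDER-OWNERS row 5 `S` slot;
(J-μ) theta share), seat planner-pub-hodgecm-mc-theta-3-g14-0 (gen 14), 2026-08-20.  Target in PKG: `HodgeCM/Model/ArchPinWeightDischarge34.lean`
(NEW additive drop-alone leaf; imports this lineage's RUN-50 (K13) `Model/ArchPinWeightDischarge` and binder-2's installed `Model/HypCensus/Side34Omg` (`swapPin`)).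
KERNEL only: 0 records / Prop-valued definitions / cites, 0 proof holes; intended closure {propext, Classical.choice, Quot.sound}.
-/
import Summits.HodgeConjecture.HodgeCM.Model.ArchPinWeightDischarge
import Summits.HodgeConjecture.HodgeCM.Model.HypCensus.Side34Omg

/-!
# (J-μ)₃₄ DISCHARGED AT THE W PIN: binder-2's scalar identity `hμ₃₄` at the swapped torus point, under the OG guard

Row 19 of E lives on the torus `jT₃₄`; binder-2's (34) census junction (#53 `Side34Omg`, (T12)/(ORIENTATION-34) N3′
`HypCensus.omgW_ins₃₄_eq_of_weight`) reduces it to ONE scalar identity, the (12) identity READ AT THE SWAPPED POINT `swapPin c.D u_t`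
(`swapPin = torusSwap σ₃₄`, `σ₃₄ w = (placePerm w)⁻¹`, binder-2 #52 `IsoTwist`) with the slot-2/3 exponents `m₁ := −μ♯♯ c 2`, `m₂ := −μ♯♯ c 3`:

  `hμ₃₄ : ∀ t, η(1, (diag (swapPin u_t))_𝔸) · χ_T(swapPin u_t) · dIotaAt(swapPin u_t) = (printPlacesW … t)⁻¹`.

By (K12) at `u := swapPin c.D u_t` and (K13) §1 this is the TORUS IDENTITY

  `weight (μ♯♯ c 0) (μ♯♯ c 1) (swapPin c.D u) = weight (μ♯♯ c 2) (μ♯♯ c 3) u`     (`weight_muSharp₂₃_swapPin`),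

which holds place by place from (K10)'s closed tables: `μ♯♯ c 1 = μ c 0 + δ`, `μ♯♯ c 2 = μ c 0 + δ₂`, `μ♯♯ c 3 = μ c 0 + δ₃` with
`(δ₂, δ₃) = (δ, 0)` on the relabelling bit `conjSwapAt` and `(0, δ)` off it ((K10) `slotDelta₂/₃_of_(not_)conjSwapAt`), while
`placePerm w` is the swap exactly on the bit (`placePerm_of_conjSwapAt`, both read the sign of `Re w(a₀)` against `Re w(a₂)`).

## Main statements (namespace `HodgeCM.Model.ArchSideTerm`)

* `placePerm_of_conjSwapAt` / `placePerm_of_not_conjSwapAt`: binder-2's place permutation IS (K7)'s relabelling bit.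
* `weight_swapPin` (§1): `weight n (n + δ) (swapPin S u) = weight (n + δ₂) (n + δ₃) u`; `weight_muSharp₂₃_swapPin` (in `μ♯♯`'s letters).
* **`hμ₃₄_GOG`** (§2): binder-2's `hμ₃₄` AT E's PIN OF RECORD, for every guarded `(V, c)`, every sign fact `hW`, every `datum`, every `t`.
  Consumer recipe: `homg₃₄ V c := fun hW f t φ => HypCensus.omgW_ins₃₄_eq_of_weight … (hμ₃₄_GOG … V c hc hW _) f t φ`.
-/

set_option autoImplicit false

noncomputable section

open scoped Matrix Classical
open NumberField (InfinitePlace maximalRealSubfield IsCMField)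
open NumberField.mixedEmbedding (mixedSpace)
open Literature.NumberTheory.Automorphic Literature.NumberTheory.Automorphic.UnitaryGroup
open Literature.NumberTheory.GelbartRogawski1991 Literature.NumberTheory.GelbartRogawski1991.UnitaryDualPair
open HodgeCM.Adelic HodgeCM.PerL34 HodgeCM.Model.HypCensus
open HodgeCM.PerL34.Fock HodgeCM.PerL34.Fock.PrintDict

namespace HodgeCM.Model.ArchSideTerm

/-! ## §0 two circle-pair evaluations and the typed-weight currency -/

section Pairs

/-- the inverse of the identity permutation leaves a circle pair alone … -/
theorem permPair_symm_one (p : Circle × Circle) : permPair (1 : Equiv.Perm (Fin 2)).symm p = p := rfl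

/-- … and the inverse of the swap swaps it. -/
theorem permPair_symm_swap (p : Circle × Circle) : permPair (Equiv.swap (0 : Fin 2) 1).symm p = (p.2, p.1) := rfl

variable {L : Type} [Field L] [NumberField L] [IsCMField L]

/-- the PKG typed weight of `T(L⁺ ⊗ ℝ)` in the Literature currency of the theta side (definitional). -/
theorem weight_eq_archWeight_mul (m₁ m₂ : InfinitePlace L → ℤ) (u : NumberField.SeesawArchTorus L) :
    NumberField.SeesawArchTorus.weight L m₁ m₂ u =
      Literature.NumberTheory.Automorphic.archWeight L m₁ (NumberField.SeesawArchTorus.fst L u) *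
        Literature.NumberTheory.Automorphic.archWeight L m₂ (NumberField.SeesawArchTorus.snd L u) := rfl

end Pairs

/-! ## §1 the torus identity behind `hμ₃₄` -/

section Swap

variable {L : CMField} (S : StubTree.SeesawDatum L)

/-- binder-2's place permutation is the SWAP on (K7)'s relabelling bit … -/
theorem placePerm_of_conjSwapAt {w : InfinitePlace (L : Type)} (h : conjSwapAt S w) :
    placePerm (L : Type) (dW S) (dW' S) w = Equiv.swap 0 1 :=
  if_neg h

/-- … and the IDENTITY off it. -/
theorem placePerm_of_not_conjSwapAt {w : InfinitePlace (L : Type)} (h : ¬ conjSwapAt S w) :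
    placePerm (L : Type) (dW S) (dW' S) w = 1 :=
  if_pos (not_not.mp h)

/-- **THE TORUS IDENTITY**: `weight n (n + δ) (swapPin S u) = weight (n + δ₂) (n + δ₃) u` for every `n` and `u`. -/
theorem weight_swapPin (n : InfinitePlace (L : Type) → ℤ) (u : NumberField.SeesawArchTorus (L : Type)) :
    NumberField.SeesawArchTorus.weight (L : Type) n (n + slotDelta S) (swapPin S u) =
      NumberField.SeesawArchTorus.weight (L : Type) (n + slotDelta₂ S) (n + slotDelta₃ S) u := by
  rw [← NumberField.SeesawArchTorus.placesWeight_placesEquiv, ← NumberField.SeesawArchTorus.placesWeight_placesEquiv,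
    NumberField.SeesawArchTorus.placesWeight_apply, NumberField.SeesawArchTorus.placesWeight_apply]
  refine Finset.prod_congr rfl fun w _ => ?_
  have hsw : NumberField.SeesawArchTorus.placesEquiv (L : Type) (swapPin S u) w =
      permPair (placePerm (L : Type) (dW S) (dW' S) w).symm (NumberField.SeesawArchTorus.placesEquiv (L : Type) u w) :=
    placesEquiv_torusSwap (L : Type) _ u w
  rw [hsw, Pi.add_apply, Pi.add_apply, Pi.add_apply]
  by_cases h : conjSwapAt S w
  · rw [placePerm_of_conjSwapAt S h, slotDelta₂_of_conjSwapAt S h, slotDelta₃_of_conjSwapAt S h, permPair_symm_swap, add_zero, mul_comm]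
  · rw [placePerm_of_not_conjSwapAt S h, slotDelta₂_of_not_conjSwapAt S h, slotDelta₃_of_not_conjSwapAt S h, permPair_symm_one, add_zero]

/-- the same in the letters of (K10)'s adapter `μ♯♯`: `weight (μ♯♯ c 0) (μ♯♯ c 1) (swapPin c.D u) = weight (μ♯♯ c 2) (μ♯♯ c 3) u`. -/
theorem weight_muSharp₂₃_swapPin (μ : ∀ {L : CMField}, SeesawCtx L → Fin 4 → NumberField.InfinitePlace L → ℤ) (c : SeesawCtx L)
    (u : NumberField.SeesawArchTorus (L : Type)) :
    NumberField.SeesawArchTorus.weight (L : Type) (muSharp₂₃ @μ c 0) (muSharp₂₃ @μ c 1) (swapPin c.D u) =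
      NumberField.SeesawArchTorus.weight (L : Type) (muSharp₂₃ @μ c 2) (muSharp₂₃ @μ c 3) u := by
  rw [muSharp₂₃_zero, muSharp₂₃_one, muSharp₂₃_two, muSharp₂₃_three]
  exact weight_swapPin c.D (μ c 0) u

end Swap

/-! ## §2 `hμ₃₄` at E's pin of record -/

section GOG

variable
  (hGR : ∀ {L : CMField} {ι₁ : L →+* ℂ} (V : HermSpace3 L ι₁) (c : SeesawCtx L),
    (cmSplittingDatum (L : Type) finProdFinEquiv (frameD V) (frameD_real V) (frameD_ne V) (dW c.D) (dW_real c.D)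
      (dW_ne c.D)).CompatibleSplitting)
  (χV : ∀ {L : CMField} {ι₁ : L →+* ℂ} (_V : HermSpace3 L ι₁) (_c : SeesawCtx L),
    ContinuousMonoidHom (relNormOneIdeles (↥(maximalRealSubfield (L : Type))) (L : Type) ⧸
      relNormOneRat (↥(maximalRealSubfield (L : Type))) (L : Type)) Circle)
  (hGR₀ : ∀ {L : CMField} {ι₁ : L →+* ℂ} (V : HermSpace3 L ι₁) (c : SeesawCtx L),
    (cmSplittingDatum (L : Type) (e₁) (frameD V) (frameD_real V) (frameD_ne V) (lineVec (L : Type) (dW c.D 0))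
      (fun _ => dW_real c.D 0) (fun _ => dW_ne c.D 0)).CompatibleSplitting)
  (hGR₁ : ∀ {L : CMField} {ι₁ : L →+* ℂ} (V : HermSpace3 L ι₁) (c : SeesawCtx L),
    (cmSplittingDatum (L : Type) (e₁) (frameD V) (frameD_real V) (frameD_ne V) (lineVec (L : Type) (dW c.D 1))
      (fun _ => dW_real c.D 1) (fun _ => dW_ne c.D 1)).CompatibleSplitting)
  (hGR₂ : ∀ {L : CMField} {ι₁ : L →+* ℂ} (V : HermSpace3 L ι₁) (c : SeesawCtx L),
    (cmSplittingDatum (L : Type) (e₁) (frameD V) (frameD_real V) (frameD_ne V) (lineVec (L : Type) (dW' c.D 0))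
      (fun _ => dW'_real c.D 0) (fun _ => dW'_ne c.D 0)).CompatibleSplitting)
  (hGR₃ : ∀ {L : CMField} {ι₁ : L →+* ℂ} (V : HermSpace3 L ι₁) (c : SeesawCtx L),
    (cmSplittingDatum (L : Type) (e₁) (frameD V) (frameD_real V) (frameD_ne V) (lineVec (L : Type) (dW' c.D 1))
      (fun _ => dW'_real c.D 1) (fun _ => dW'_ne c.D 1)).CompatibleSplitting)
  (μ : ∀ {L : CMField}, SeesawCtx L → Fin 4 → NumberField.InfinitePlace L → ℤ)

include hGR₂ hGR₃ in
/-- **binder-2's `hμ₃₄` AT E's PIN OF RECORD, DISCHARGED** (OG guard `SInstance.GOG`; Stage-B η with `χW := SInstance.χWR … (μ♯♯)`,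
`μ♯♯ := muSharp₂₃ μ`; pinned exponents `m₁ := −μ♯♯ c 2`, `m₂ := −μ♯♯ c 3`; ANY place-datum family `datum`, ANY sign fact `hW`):
`η(1, (diag u')_𝔸) · χ_T(u') · dIotaAt(u') = (printPlacesW … t)⁻¹` at the SWAPPED point `u' := swapPin c.D (archOf … t)` — literally the
hypothesis `hμ` of (T12)/(ORIENTATION-34) `HypCensus.omgW_ins₃₄_eq_of_weight` (`muScalar34 … t * dIotaAt … = (printPlacesW … t)⁻¹`). -/
theorem hμ₃₄_GOG {L : CMField} {ι₁ : L →+* ℂ} (V : HermSpace3 L ι₁) (c : SeesawCtx L) (hc : SInstance.GOG V c)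
    (hW : (∀ j, 0 < (ι₁ ((dW c.D) j)).re) ∨ ∀ j, (ι₁ ((dW c.D) j)).re < 0)
    (datum : ∀ b : InfinitePlace (L : Type),
      PlaceDatum (L : Type) (frameD V) (frameD_real V) (dW c.D) (dW_real c.D) ι₁ (cmPlacesEquiv (L : Type) b))
    (t : (printPlaces (InfinitePlace (L : Type)) (kindOf (L : Type) (frameD V) (frameD_real V) (dW c.D) (dW_real c.D) ι₁ datum)
      (lamOf (L : Type) (frameD V) (frameD_real V) (dW c.D) (dW_real c.D) ι₁ datum)
      (lamOf_ne_zero (L : Type) (frameD V) (frameD_real V) (dW c.D) (dW_real c.D) ι₁ datum)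
      (pinnedVacs (kindOf (L : Type) (frameD V) (frameD_real V) (dW c.D) (dW_real c.D) ι₁ datum)
        (fun w => -(muSharp₂₃ @μ) c 2 w) (fun w => -(muSharp₂₃ @μ) c 3 w))).Tg) :
    ((EtaChi.η @χV (@SInstance.χWR @hGR @hGR₀ @hGR₁ (muSharp₂₃ @μ)) V c
        (archProdHom (↥(maximalRealSubfield (L : Type))) (L : Type) (IsCMField.complexConj (L : Type)) 3 2 (Matrix.diagonal (frameD V))
          (Matrix.diagonal (dW c.D))
          ((1 : ↥(UnitaryGroup.arch (↥(maximalRealSubfield (L : Type))) (L : Type) (IsCMField.complexConj (L : Type)) 3 (Matrix.diagonal (frameD V)))),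
            archDiag (L : Type) (dW c.D)
              (swapPin c.D (archOf V c.D datum (fun w => -(muSharp₂₃ @μ) c 2 w) (fun w => -(muSharp₂₃ @μ) c 3 w) t)))) : ℂˣ) : ℂ) *
        ((pinTorusChar V c.D (hGR V c) hW
            (swapPin c.D (archOf V c.D datum (fun w => -(muSharp₂₃ @μ) c 2 w) (fun w => -(muSharp₂₃ @μ) c 3 w) t)) : Circle) : ℂ) *
          HypCensus.dIotaAt (L : Type) (frameD V) (dW c.D) (dW_real c.D) ι₁
            (swapPin c.D (archOf V c.D datum (fun w => -(muSharp₂₃ @μ) c 2 w) (fun w => -(muSharp₂₃ @μ) c 3 w) t)) =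
      (printPlacesW (InfinitePlace (L : Type)) (kindOf (L : Type) (frameD V) (frameD_real V) (dW c.D) (dW_real c.D) ι₁ datum)
        (lamOf (L : Type) (frameD V) (frameD_real V) (dW c.D) (dW_real c.D) ι₁ datum)
        (lamOf_ne_zero (L : Type) (frameD V) (frameD_real V) (dW c.D) (dW_real c.D) ι₁ datum)
        (pinnedVacs (kindOf (L : Type) (frameD V) (frameD_real V) (dW c.D) (dW_real c.D) ι₁ datum)
          (fun w => -(muSharp₂₃ @μ) c 2 w) (fun w => -(muSharp₂₃ @μ) c 3 w)) t)⁻¹ := by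
  rw [eta_pinTorusChar_dIotaAt_GOG hGR χV hGR₀ hGR₁ hGR₂ hGR₃ μ V c hc, inv_printPlacesW_pinned_neg, ← weight_eq_archWeight_mul,
    ← weight_eq_archWeight_mul]
  exact weight_muSharp₂₃_swapPin μ c _

end GOG

end HodgeCM.Model.ArchSideTerm

end
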